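import Summits.Ventures.Crystal3D.Bulk.TwelveNeighbourGap
import Summits.Ventures.Crystal3D.Bulk.GapReduction
import Summits.Ventures.Crystal3D.Bulk.IntruderWitness
import HarnessLib

/-!
# The gap statements of the two phase-2 typers are equivalent

HONEST FRAMING. Part of the venture `Summits/Ventures/Crystal3D` (cell `pub-crystal3d`, phase 2,
PLAN R41 "target = GAP"). Glue file, pure theorems: the cell now has THREE renderings of the
twelve-neighbour gap — `TwelveNeighbourGap ρ` (`Bulk/TwelveNeighbourGap.lean`: finite labelled
packings of unit-DIAMETER balls, the vocabulary of `BulkCrystallization3D`), `GapTupleDiam d₀`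
(`Bulk/GapReduction.lean`: one fourteen-ball configuration, diameter `1` — the shape the cell's
engines certify and the shape of Böröczky–Szabó 2015, Theorem 3), and `KissingGap δ` (ibid.:
point-set packings of unit-RADIUS balls, Hales's normalisation, `δ = 2ρ`). This file PROVES

  `TwelveNeighbourGap ρ ↔ GapTupleDiam ρ ↔ KissingGap (2ρ)`

(the census seat theory-1's request, 2026-08-22), so that a certificate for any one of them at any
`ρ ≥ 1.26` feeds `bulkCrystallization3D_of_gap`, and records the Böröczky–Szabó instance
`BoroczkySzabo2015_thm3 → TwelveNeighbourGap (2.51838585 / 2)` and, from the second typer's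
exact fourteen-ball `IntruderWitness` (the `60° × arccos(11/27)` rectangle with an intruder at
distance `7√3/9 = 1.3471…`), the UPPER end of the window: `¬ TwelveNeighbourGap ρ` for every
`ρ > 7√3/9`. The only non-trivial inputs are the kissing number (`coordination_le_twelve`: a ball
touched by `c 1, …, c 12` cannot also touch `c 13`), the second typer's enumeration lemma
`kissingGap_of_gapTuple`, and his witness. Nothing is claimed beyond these implications.
-/

noncomputable section

open scoped BigOperators
open Finset

namespace Summit.Ventures.Crystal3D

open Literature.Geometry.DiscreteGeometry

/-! ## Point-set form ⇒ labelled form -/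

/-- **`KissingGap (2ρ) → TwelveNeighbourGap ρ`**: apply the point-set gap to the doubled packing
`{2 xⱼ}` (a packing of unit balls, `isUnitPacking_iff_two_smul`) at the centre `2 xᵢ`, whose
kissing shell has `coordination x i = 12` points, and halve. -/
theorem twelveNeighbourGap_of_kissingGap {ρ : ℝ} (hg : KissingGap (2 * ρ)) :
    TwelveNeighbourGap ρ := by
  intro N x hx i j hi hj
  have hV := isUnitBallPacking_range_two_smul hx
  have h12 :
      (kissingShell (Set.range fun k => (2 : ℝ) • x k) ((2 : ℝ) • x i)).ncard = 12 := by
    rw [ncard_kissingShell_range_two_smul hx, hi]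
  rcases hg _ hV ((2 : ℝ) • x i) ⟨i, rfl⟩ h12 ((2 : ℝ) • x j) ⟨j, rfl⟩ with h | h | h
  · exact absurd (hx.injective (smul_right_injective _ (two_ne_zero (α := ℝ)) h)).symm hj
  · left
    rw [dist_two_smul] at h
    linarith
  · right
    rw [dist_two_smul] at h
    linarith

/-- **`GapTupleDiam ρ → TwelveNeighbourGap ρ`** (through `GapTuple (2ρ)` and the enumeration
`kissingGap_of_gapTuple` of `Bulk/GapReduction.lean`). -/
theorem twelveNeighbourGap_of_gapTupleDiam {ρ : ℝ} (hg : GapTupleDiam ρ) : TwelveNeighbourGap ρ :=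
  twelveNeighbourGap_of_kissingGap (kissingGap_of_gapTuple ((gapTupleDiam_iff ρ).1 hg))

/-! ## Labelled form ⇒ fourteen-ball form -/

/-- The twelve "middle" labels `1, …, 12` of `Fin 14`. -/
private theorem card_middle :
    (univ.filter fun k : Fin 14 => k ≠ 0 ∧ k ≠ 13).card = 12 := by decide

/-- **`TwelveNeighbourGap ρ → GapTupleDiam ρ`**: a fourteen-ball configuration with pairwise
distances `≥ 1` IS a unit packing of `14` labelled balls; `c 1, …, c 12` touch `c 0`, so by the
kissing number (`coordination_le_twelve`) ball `0` has exactly twelve contacts and `c 13` is not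
one of them; the labelled gap at `i = 0`, `j = 13` then gives `dist (c 0) (c 13) ≥ ρ`. -/
theorem gapTupleDiam_of_twelveNeighbourGap {ρ : ℝ} (hg : TwelveNeighbourGap ρ) :
    GapTupleDiam ρ := by
  intro c hpack htouch
  have hx : IsUnitPacking c := fun i j hij => hpack i j hij
  -- the twelve touching balls are contact neighbours of `0`
  have hsub : (univ.filter fun k : Fin 14 => k ≠ 0 ∧ k ≠ 13) ⊆ contactNeighbors c 0 := by
    intro k hk
    rw [mem_filter] at hk
    rw [mem_contactNeighbors]
    exact ⟨hk.2.1, by rw [dist_comm]; exact htouch k hk.2.1 hk.2.2⟩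
  have h12le : 12 ≤ coordination c 0 := by
    rw [← card_middle, coordination]
    exact card_le_card hsub
  have h12 : coordination c 0 = 12 := le_antisymm (coordination_le_twelve hx 0) h12le
  -- `c 13` does not touch `c 0`: that would be a thirteenth contact
  have h13 : dist (c 0) (c 13) ≠ 1 := by
    intro h1
    have hins : insert (13 : Fin 14) (univ.filter fun k : Fin 14 => k ≠ 0 ∧ k ≠ 13) ⊆
        contactNeighbors c 0 := by
      intro k hk
      rcases mem_insert.1 hk with rfl | hk
      · rw [mem_contactNeighbors]; exact ⟨by decide, h1⟩
      · exact hsub hk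
    have hcard := card_le_card hins
    rw [card_insert_of_notMem (by simp), card_middle] at hcard
    have := coordination_le_twelve hx 0
    rw [coordination] at this
    omega
  rcases hg 14 c hx 0 13 h12 (by decide) with h | h
  · exact absurd h h13
  · exact h

/-! ## The equivalences -/

/-- **The labelled and the fourteen-ball forms of the gap are equivalent** (diameter-`1`
convention on both sides). -/
theorem twelveNeighbourGap_iff_gapTupleDiam (ρ : ℝ) : TwelveNeighbourGap ρ ↔ GapTupleDiam ρ :=
  ⟨gapTupleDiam_of_twelveNeighbourGap, twelveNeighbourGap_of_gapTupleDiam⟩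

/-- **The labelled form (diameter `1`) and the point-set form (radius `1`, gap `2ρ`) are
equivalent.** -/
theorem twelveNeighbourGap_iff_kissingGap (ρ : ℝ) : TwelveNeighbourGap ρ ↔ KissingGap (2 * ρ) :=
  ⟨fun h => kissingGap_of_gapTuple ((gapTupleDiam_iff ρ).1 (gapTupleDiam_of_twelveNeighbourGap h)),
    twelveNeighbourGap_of_kissingGap⟩

/-- **Böröczky–Szabó 2015, Theorem 3, in the labelled form**: `TwelveNeighbourGap (2.51838585 / 2)`
(`= 1.259192925`, contact-distance-`1` units; below Hales's `h₀ = 1.26`). -/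
theorem twelveNeighbourGap_of_boroczkySzabo (h : BoroczkySzabo2015_thm3) :
    TwelveNeighbourGap (2.51838585 / 2) := by
  refine twelveNeighbourGap_of_kissingGap ?_
  rw [show (2 : ℝ) * (2.51838585 / 2) = 2.51838585 by norm_num]
  exact kissingGap_of_gapTuple (boroczkySzabo2015_thm3_iff.1 h)

/-! ## The window from above -/

/-- **The labelled gap is FALSE above `7√3/9 = 1.3471…`**: the exact fourteen-ball intruder
configuration of `Bulk/IntruderWitness.lean` (twelve balls touching the centre, a thirteenth at
distance `7√3/9`) refutes `TwelveNeighbourGap ρ` for every `ρ > 7√3/9`. So a gap certificate can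
only target `ρ ∈ [1.26, 7√3/9]` as far as the reduction is concerned. -/
theorem not_twelveNeighbourGap_of_lt {ρ : ℝ} (h : 7 * Real.sqrt 3 / 9 < ρ) :
    ¬ TwelveNeighbourGap ρ := fun hg =>
  not_gapTupleDiam_of_lt h (gapTupleDiam_of_twelveNeighbourGap hg)

/-- In particular `¬ TwelveNeighbourGap 1.3472` (while `TwelveNeighbourGap 1.26` holds under
`flyspeck_L12`, `twelveNeighbourGap_of_L12`). -/
theorem not_twelveNeighbourGap_13472 : ¬ TwelveNeighbourGap 1.3472 :=
  not_twelveNeighbourGap_of_lt Intruder.seven_sqrt_three_div_nine_bounds.2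

end Summit.Ventures.Crystal3D

end
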